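import Literature.MathematicalPhysics.QuantumFieldTheory.Balaban1983to89.B9Eq3132NuReading
import Literature.MathematicalPhysics.QuantumFieldTheory.Balaban1983to89.B9Thm312Whole
import Literature.MathematicalPhysics.QuantumFieldTheory.Balaban1983to89.B9CoReadingCoordsH
import Literature.MathematicalPhysics.QuantumFieldTheory.Balaban1983to89.B9GeoLemma21KLevelV1

/-!
# `Balaban1983to89.B9Eq3132ClassLetterFromNu` — T. Bałaban, *Propagators for lattice gauge theories in a background field*, Commun. Math.
# Phys. **99** (1985) 389–434 [Balaban1985BackgroundPropagators], (3.132) p. 422: THE `ν`-READING OF A COARSE-BOND LETTER IMPLIES THE KNIT's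
# CLASS LETTER `𝔠⁽²⁾ → (n⁻¹-weighted blocks)` FOR ITS REAL-COORDINATE MODEL (the shape of `B9Thm312WholeHZ.LettersHZ.c2 ∕ c12`)

statement-level skeleton of published theorems with citation tags; proofs where landed; nothing here is a claim about the Yang–Mills mass gap

WHY (cell `pub-ymgap`, node N06 [B9], seat `pub-ymgap-dag-n06-i` bundle F4, gen 19).  ROW 26 of the N06 certificate concludes `B9.Stmt3132Printed (d+1) c35 geo9Y bg9Y …`
for the `ν`-WEIGHTED SITE-KERNEL READING `kerν U y y′ = ν(y)ν(y′)·sup_{‖E‖≤1}‖(O U)(δ_{y′} ⊗ E)(y)‖` (`B9Eq3132NuReading`, `ν = nuY (d+1)`); rows 20–21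
DISPLAY the same (3.132) content as the class letters `LettersHZ.c2 ∕ c12 : HasMaj 𝔠_Z⁽²⁾ bZ (𝔬.C U) (B₃e^{−δ₃d})`, `bZ = weightNorm (ofBlocks … blkHK) n⁻¹`
(`n(y) = L^{(d+1)j(y)}`; dag-n06-l's schema `B9Thm312WholeHZ`; dag-n06-d's pins `hCco12 ∕ hC1co12 ∕ hblkZ12`, `CcoK … U = cR39 b • coordOpK b (fun _ =>
(QGQinvY … U).restrictScalars ℝ)`).  dag-n06-w5 located the missing link («an OPERATOR-level (3.132) face … row 26 lives in n06-i's ν-reading»); this file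
is that link, for an ARBITRARY letter `O`: `B9.Ineq3132 (d+1) kerν C δ₁ U ⟹ HasMaj (cNorm R₀ H₀ blkHK _ 2) (weightNorm (ofBlocks (toB6 (geo9K i) R₀ H₀) blkHK) n⁻¹ _)
(c • coordOpK b (fun _ => (O U).restrictScalars ℝ)) ((|c|·M₂·S_b·C·L²)·e^{−δ₃d})` for every `δ₃ < δ₁` at every index with `2·log L ≤ (δ₁ − δ₃)·(2L² − 1)·M`
(`M₂` = the coordinate bound `|repr_a v| ≤ M₂‖v‖` of the real basis `b`, `S_b = Σ_a ‖b_a‖`).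

THE ARITHMETIC (exact, η-free).  A coordinate of `c • coordOpK b O μ` over `y`, `μ` localised on the block of `y′`, is `c·repr_a((O U)(δ_{y′} ⊗ E_{ν a′})(y))`,
`‖E_{ν a′}‖ ≤ S_b·sup|μ|`, so it is `≤ |c|·M₂·S_b·kerflat(y, y′)·sup|μ|`; (3.132) gives `kerflat ≤ C·len(y)⁻²·len(y′)^{−(d+1)}·e^{−δ₁d}∕(ν(y)ν(y′))` and the identity
`ν(y)ν(y′) = n(y)⁻¹·len(y′)^{−(d+1)}` (§1: `ν(y) = η^{(d+1)∕2}·len(y)^{−(d+1)}`, `n(y)⁻¹ = η^{d+1}·len(y)^{−(d+1)}`) leaves `|c|·M₂·S_b·C·len(y)⁻²·e^{−δ₁d}`;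
[4] (2.60) (`B9GeoLemma21KLevelV1.transferL_geo9K`, `q = −2`) turns `len(y)⁻²` into `L²·e^{(δ₁−δ₃)d}·len(y′)⁻²` = the 𝔠⁽²⁾ weight at `y′`.

WHAT IS PROVED (sorry-free, standard axioms; 0 `def`).  §1 `len_eq_pow_mul_eta`, `eta_eq` (`rfl`), `levelWeight_eq_eta_rpow_mul`, `nuY_succ_eq_eta_rpow_mul`,
★ `nuY_mul_nuY_eq_levelWeight_mul`.  §2 `deltaY_smul_real`, `norm_apply_deltaY_le_of_repr'` (def-Y's real-basis device, re-proved to keep the import cone small),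
`norm_apply_deltaY_le_norm_mul_siteKernelOfOp_ker`, `assembleK_eq_deltaY_of_off`, `norm_sliceAmplitude_le`.  §3 ★★ `hasMajorant_smul_coordOpK_of_siteKernel`,
`hasMaj_ofBlocks_smul_coordOpK_of_siteKernel`, ★★★ `hasMaj_cNorm_weightNorm_coordOpK_of_ineq3132Nu` (index level, ANY letter `O`, any `R₀ H₀ c b`).  §4 ★★
`hasMaj_cNorm_weightNorm_coordOpK_geo9Y_of_ineq3132Nu` (member `x`, geometry `geo9Y x`, the certificate's spelling).  §5 ★★★ `hasMaj_cNorm_weightNorm_coordOpK_of_stmt3132Nu`: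
from ROW 26's `B9.Stmt3132Printed (d+1) c35 geo9Y bg9Y (ν-reading of T) (ν-reading of T₁)`, `∃ M₄ δ₃ a₀ B₃ > 0` giving BOTH class letters member-uniformly (`δ₃ = δ₁∕2`).

CONSUMER NOTE (dag-n06-d ∕ dag-n06-w5).  At the pins, `(𝔬12 x).C U = cR39 (trBasis N) • coordOpK (trBasis N) (fun _ => (QGQinvY … Gp U).restrictScalars ℝ)`
(`Node00.OpsYSectDCoords.CcoK`, `rfl`) and row 26's instance reads `(opsYNu… x).QGQinv = siteKernelOfOpNu x.toKIdx (bg9Y …) (fun U => U) (nuY (d+1) x.toKIdx)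
(𝔏 x).QGQinv` (`B9Eq3132NuReading.operatorLayerYNu_fields`, `rfl`): §4 with `O := (𝔏 x).QGQinv`, `c := cR39 (trBasis N)`, `b := trBasis N`, `R₀ := 1`, `H₀ := H x` IS the
field `LettersHZ.c2` of `hlettersH12` (the same with `QG1Qinv ∕ C1coK` for `c12`); row 26's printed statement hides `δ₁, C` — `obtain` them first, or use §5.

HONEST SCOPE.  Norm-currency bookkeeping between two readings of the SAME operator; (3.132) itself stays the certificate's (row 26's) business; nothing of
[B9] is asserted here.  COUNT-NEUTRAL; N06 NOT discharged; nothing continuum ∕ OS ∕ mass-gap ∕ Clay.  A NEW file.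
-/


namespace Literature.MathematicalPhysics.QuantumFieldTheory.Balaban1983to89.B9Eq3132ClassLetterFromNu

open Node00
open B6KLevelCensusIndexV1 (KIdx)
open B6Ineq2142KLevelV1 (lvl)
open B9PinMembersKLevelV1 (MemberY geo9Y bg9Y)
open B9GeoNormsKLevelV1 (geo9K)
open B9Eq3132NuReading (siteKernelOfOpNu siteKernelOfOpNu_ker nuY nuY_pos lamY lamY_pos)
open B9Eq3132RingInverseReading (siteKernelOfOp_ker_nonneg)
open B9CoReadingCoords (coordOpK assembleK)
open B9CoReadingCoordsH (XHK blkHK)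
open B9Thm312Whole (cNorm)
open B9Thm34Ext (toB6)
open B9SectDSup (weightNorm)
open B11SectG (HasMaj BlockNorm hasMaj_of_hasMajorant)
open B6RandomWalk (HasMajorant BlockSupp)
open B6Cor28 (TransferL)
open B9GeoLemma21KLevelV1 (transferL_geo9K geo9K_len_pos geo9K_eta_pos geo9K_dist_comm geo9K_one_le_L)

noncomputable section

variable {𝔸 : Type} [NormedRing 𝔸] [NormedAlgebra ℂ 𝔸] [CompleteSpace 𝔸]
variable {d ℓ : ℕ} {hd : 1 ≤ d + 1} {hL : Odd (ℓ + 1) ∧ 1 < ℓ + 1} {b₀ b₁ : ℝ}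

/-! ## §1 The weight identities: `n(y)⁻¹ = η^{d+1}·len(y)^{−(d+1)}`, `ν(y) = η^{(d+1)∕2}·len(y)^{−(d+1)}` -/

section Weights

variable (i : KIdx d ℓ hd hL b₀ b₁)

/-- `len(y) = L^{j(y)}·η` with `η = |c_f|⁻¹` and `L = ℓ + 1` (the reading of record, unfolded). [cite: Balaban1985BackgroundPropagators, (3.41) p.397 («Lʲη»), bookkeeping] -/
theorem len_eq_pow_mul_eta (y : (geo9K i).Site) :
    (geo9K i).len y = (((ℓ + 1 : ℕ) : ℝ)) ^ (lvl i.hN i.D i.hk y) * (geo9K i).eta := rfl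

/-- `η = |c_f|⁻¹` at the reading of record. [cite: Balaban1984PropagatorsII, (2.1) p.224 (η = L^{−k}), bookkeeping] -/
theorem eta_eq (i : KIdx d ℓ hd hL b₀ b₁) : (geo9K i).eta = |i.cf|⁻¹ := rfl

/-- ★ **THE BLOCK-COUNT WEIGHT IN PHYSICAL LENGTHS**: `n(y)⁻¹ = (L^{(d+1)})^{−j(y)} = η^{d+1}·len(y)^{−(d+1)}`.
[cite: Balaban1985BackgroundPropagators, (3.41) p.397 + p.398 (remark after (3.47): the normalisation powers), bookkeeping] -/
theorem levelWeight_eq_eta_rpow_mul (y : (geo9K i).Site) :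
    (((((ℓ + 1 : ℕ) : ℝ)) ^ (d + 1)) ^ (lvl i.hN i.D i.hk y))⁻¹ =
      (geo9K i).eta ^ (((d + 1 : ℕ) : ℝ)) * (geo9K i).len y ^ (-(((d + 1 : ℕ) : ℝ))) := by
  have hη : 0 < (geo9K i).eta := geo9K_eta_pos i; have hlen : 0 < (geo9K i).len y := geo9K_len_pos i y
  have hLpow : (((ℓ + 1 : ℕ) : ℝ)) ^ (lvl i.hN i.D i.hk y) = (geo9K i).len y / (geo9K i).eta := by
    rw [len_eq_pow_mul_eta, mul_div_assoc, div_self hη.ne', mul_one]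
  rw [← pow_mul, mul_comm (d + 1), pow_mul, hLpow, div_pow, inv_div, Real.rpow_neg hlen.le, Real.rpow_natCast, Real.rpow_natCast,
    div_eq_mul_inv]

/-- ★ **THE READING WEIGHT IN PHYSICAL LENGTHS**: `ν(y) = (Lʲη)^{−(1+(d+1)∕2)}·Λ_y = η^{(d+1)∕2}·len(y)^{−(d+1)}` (`Λ_y² = (Lʲ∕c_f)²·L^{−j(d+1)} = len(y)²·n(y)⁻¹`).
[cite: Balaban1984PropagatorsII, (2.81) p.237 + (2.142) p.248 (Λ); Balaban1985BackgroundPropagators, (3.132) p.422, bookkeeping] -/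
theorem nuY_succ_eq_eta_rpow_mul (y : (geo9K i).Site) :
    nuY (d + 1) i y = (geo9K i).eta ^ ((((d + 1 : ℕ) : ℝ)) / 2) * (geo9K i).len y ^ (-(((d + 1 : ℕ) : ℝ))) := by
  have hη : 0 < (geo9K i).eta := geo9K_eta_pos i; have hlen : 0 < (geo9K i).len y := geo9K_len_pos i y
  set D : ℝ := ((d + 1 : ℕ) : ℝ) with hD
  have hwt : B6Prop27KLevelV1.wt i.hN i.D i.hk i.cf y =
      (geo9K i).len y ^ 2 * (((((ℓ + 1 : ℕ) : ℝ)) ^ (d + 1)) ^ (lvl i.hN i.D i.hk y))⁻¹ := by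
    unfold B6Prop27KLevelV1.wt; congr 1; rw [div_pow, len_eq_pow_mul_eta, eta_eq, mul_pow, inv_pow, sq_abs, div_eq_mul_inv]
  have hlam : lamY i y = (geo9K i).len y * Real.sqrt ((((((ℓ + 1 : ℕ) : ℝ)) ^ (d + 1)) ^ (lvl i.hN i.D i.hk y))⁻¹) := by
    show B6Prop27KLevelV1.lam i.hN i.D i.hk i.cf y = _; unfold B6Prop27KLevelV1.lam; rw [hwt, Real.sqrt_mul (sq_nonneg _), Real.sqrt_sq hlen.le]
  have hsqrt : Real.sqrt ((((((ℓ + 1 : ℕ) : ℝ)) ^ (d + 1)) ^ (lvl i.hN i.D i.hk y))⁻¹) =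
      (geo9K i).eta ^ (D / 2) * (geo9K i).len y ^ (-(D / 2)) := by
    rw [levelWeight_eq_eta_rpow_mul, Real.sqrt_eq_rpow, Real.mul_rpow (Real.rpow_nonneg hη.le _) (Real.rpow_nonneg hlen.le _),
      ← Real.rpow_mul hη.le, ← Real.rpow_mul hlen.le]
    congr 2 <;> ring
  unfold nuY; rw [show (((d + 1 : ℕ) : ℕ) : ℝ) = D from rfl] at *; rw [hlam, hsqrt]
  have h1 : (geo9K i).len y ^ (-(1 + D / 2)) * ((geo9K i).len y * ((geo9K i).len y ^ (-(D / 2)))) = (geo9K i).len y ^ (-D) := by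
    rw [show (geo9K i).len y * (geo9K i).len y ^ (-(D / 2)) = (geo9K i).len y ^ (1 : ℝ) * (geo9K i).len y ^ (-(D / 2)) by
      rw [Real.rpow_one], ← Real.rpow_add hlen, ← Real.rpow_add hlen]
    congr 1; ring
  calc (geo9K i).len y ^ (-(1 + D / 2)) * ((geo9K i).len y * ((geo9K i).eta ^ (D / 2) * (geo9K i).len y ^ (-(D / 2))))
      = (geo9K i).eta ^ (D / 2) * ((geo9K i).len y ^ (-(1 + D / 2)) * ((geo9K i).len y * (geo9K i).len y ^ (-(D / 2)))) := by ring
    _ = (geo9K i).eta ^ (D / 2) * (geo9K i).len y ^ (-D) := by rw [h1]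

/-- ★★ **THE KEY IDENTITY**: `ν(y)·ν(y′) = n(y)⁻¹·len(y′)^{−(d+1)}` — the product reading weight of (3.132) IS the knit's block-count weight at `y`
times the printed normalisation `(L^{j′}η)^{−(d+1)}` at `y′` (η-free). [cite: Balaban1985BackgroundPropagators, (3.132) p.422 + p.398 (remark after (3.47)), bookkeeping] -/
theorem nuY_mul_nuY_eq_levelWeight_mul (y y' : (geo9K i).Site) :
    nuY (d + 1) i y * nuY (d + 1) i y' =
      (((((ℓ + 1 : ℕ) : ℝ)) ^ (d + 1)) ^ (lvl i.hN i.D i.hk y))⁻¹ * (geo9K i).len y' ^ (-(((d + 1 : ℕ) : ℝ))) := by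
  have hη : 0 < (geo9K i).eta := geo9K_eta_pos i; rw [nuY_succ_eq_eta_rpow_mul, nuY_succ_eq_eta_rpow_mul, levelWeight_eq_eta_rpow_mul]
  have hh : (geo9K i).eta ^ ((((d + 1 : ℕ) : ℝ)) / 2) * (geo9K i).eta ^ ((((d + 1 : ℕ) : ℝ)) / 2) = (geo9K i).eta ^ (((d + 1 : ℕ) : ℝ)) := by
    rw [← Real.rpow_add hη]; congr 1; ring
  calc (geo9K i).eta ^ ((((d + 1 : ℕ) : ℝ)) / 2) * (geo9K i).len y ^ (-(((d + 1 : ℕ) : ℝ))) *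
        ((geo9K i).eta ^ ((((d + 1 : ℕ) : ℝ)) / 2) * (geo9K i).len y' ^ (-(((d + 1 : ℕ) : ℝ))))
      = ((geo9K i).eta ^ ((((d + 1 : ℕ) : ℝ)) / 2) * (geo9K i).eta ^ ((((d + 1 : ℕ) : ℝ)) / 2)) *
          (geo9K i).len y ^ (-(((d + 1 : ℕ) : ℝ))) * (geo9K i).len y' ^ (-(((d + 1 : ℕ) : ℝ))) := by ring
    _ = _ := by rw [hh]

end Weights

/-! ## §2 Reading lemmas: every amplitude is dominated by the site kernel; a block-localised coordinate vector re-assembles to `δ_{y′} ⊗ E` -/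

section Reading

variable {κ : Type} [Fintype κ] (b : Module.Basis κ ℝ 𝔸)

omit [CompleteSpace 𝔸] in
/-- `δ_w ⊗ (r•E) = r • (δ_w ⊗ E)` for real `r`. [cite: Balaban1985BackgroundPropagators, (3.132) p.422 (amplitudes), bookkeeping] -/
theorem deltaY_smul_real {X : Type} [DecidableEq X] (w : X) (r : ℝ) (E : 𝔸) : deltaY w (r • E) = r • deltaY w E := by
  funext z; by_cases hz : z = w <;> simp [deltaY, hz]

omit [CompleteSpace 𝔸] in
/-- the real-basis device: `‖(O(δ_w ⊗ E))(z)‖ ≤ M₂·Σ_j ‖(O(δ_w ⊗ b_j))(z)‖` for `‖E‖ ≤ 1` (adapted from def-Y's `Node00.OpsYSiteKernelPair.norm_apply_deltaY_le_of_repr`,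
re-proved here to keep the import cone small). [cite: Balaban1985BackgroundPropagators, (3.48) p.398 (sup over the amplitude), bookkeeping] -/
theorem norm_apply_deltaY_le_of_repr' {X Y : Type} [DecidableEq Y] (O : (Y → 𝔸) →ₗ[ℂ] (X → 𝔸)) {M₂ : ℝ} (hM₂ : 0 ≤ M₂)
    (hrepr : ∀ (v : 𝔸) (j : κ), |b.repr v j| ≤ M₂ * ‖v‖) (w : Y) {E : 𝔸} (hE : ‖E‖ ≤ 1) (z : X) :
    ‖O (deltaY w E) z‖ ≤ M₂ * ∑ j, ‖O (deltaY w (b j)) z‖ := by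
  have hΔ : deltaY w E = ∑ j, (b.repr E j) • deltaY w (b j) := by
    funext z; rw [Finset.sum_apply]; simp only [deltaY, Pi.smul_apply]; split_ifs with h
    · exact (b.sum_repr E).symm
    · simp
  have hsum : O (deltaY w E) = ∑ j, (b.repr E j) • O (deltaY w (b j)) := by
    rw [hΔ, map_sum]
    exact Finset.sum_congr rfl fun j _ => LinearMap.map_smul_of_tower O (b.repr E j) _
  rw [hsum, Finset.sum_apply, Finset.mul_sum]
  refine (norm_sum_le _ _).trans (Finset.sum_le_sum fun j _ => ?_)
  rw [Pi.smul_apply, norm_smul, Real.norm_eq_abs]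
  exact mul_le_mul_of_nonneg_right ((hrepr E j).trans (mul_le_of_le_one_right hM₂ hE)) (norm_nonneg _)

/-- ★ **EVERY AMPLITUDE IS DOMINATED BY THE SITE KERNEL**: `‖(O(U)(δ_{y′} ⊗ E))(y)‖ ≤ ‖E‖·sup_{‖E′‖≤1}‖(O(U)(δ_{y′} ⊗ E′))(y)‖` (scaling to the unit ball;
the sup is over a bounded set by the real-basis device). [cite: Balaban1985BackgroundPropagators, (3.132) p.422 (the reading), bookkeeping] -/
theorem norm_apply_deltaY_le_norm_mul_siteKernelOfOp_ker (i : KIdx d ℓ hd hL b₀ b₁) (B : B9.Backgrounds) (cfg : B.Cfg → CfgY 𝔸 i)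
    (O : CfgY 𝔸 i → (IBondY i → 𝔸) →ₗ[ℂ] (IBondY i → 𝔸)) {M₂ : ℝ} (hM₂ : 0 ≤ M₂) (hrepr : ∀ (v : 𝔸) (j : κ), |b.repr v j| ≤ M₂ * ‖v‖)
    (U : B.Cfg) (y y' : IBondY i) (E : 𝔸) :
    ‖O (cfg U) (deltaY y' E) y‖ ≤ ‖E‖ * (siteKernelOfOp i B cfg O id id).ker U y y' := by
  have hker0 : 0 ≤ (siteKernelOfOp i B cfg O id id).ker U y y' := siteKernelOfOp_ker_nonneg i B cfg O id id U y y'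
  by_cases hE : E = 0
  · subst hE; have h0 : deltaY (X := IBondY i) y' (0 : 𝔸) = 0 := by funext z; simp [deltaY]
    rw [h0, map_zero, Pi.zero_apply]; simp
  · have hEpos : 0 < ‖E‖ := norm_pos_iff.2 hE
    set E₁ : 𝔸 := (‖E‖⁻¹ : ℝ) • E with hE₁
    have hE₁n : ‖E₁‖ ≤ 1 := by rw [hE₁, norm_smul, Real.norm_eq_abs, abs_inv, abs_norm, inv_mul_cancel₀ hEpos.ne']
    have hEE : E = (‖E‖ : ℝ) • E₁ := by rw [hE₁, smul_smul, mul_inv_cancel₀ hEpos.ne', one_smul]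
    have hbdd : BddAbove (Set.range fun E' : BallY 𝔸 => ‖O (cfg U) (deltaY (id y') (E' : 𝔸)) (id y)‖) :=
      ⟨M₂ * ∑ j, ‖O (cfg U) (deltaY y' (b j)) y‖, by
        rintro _ ⟨E', rfl⟩
        exact norm_apply_deltaY_le_of_repr' b (O (cfg U)) hM₂ hrepr y' (mem_closedBall_zero_iff.1 E'.2) y⟩
    have hsup : ‖O (cfg U) (deltaY y' E₁) y‖ ≤ (siteKernelOfOp i B cfg O id id).ker U y y' :=
      le_ciSup (f := fun E' : BallY 𝔸 => ‖O (cfg U) (deltaY (id y') (E' : 𝔸)) (id y)‖) hbdd ⟨E₁, mem_closedBall_zero_iff.2 hE₁n⟩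
    calc ‖O (cfg U) (deltaY y' E) y‖ = ‖(‖E‖ : ℝ) • O (cfg U) (deltaY y' E₁) y‖ := by
          rw [hEE, deltaY_smul_real, LinearMap.map_smul_of_tower, Pi.smul_apply]
          rw [← hEE]
      _ = ‖E‖ * ‖O (cfg U) (deltaY y' E₁) y‖ := by rw [norm_smul, Real.norm_eq_abs, abs_norm]
      _ ≤ ‖E‖ * (siteKernelOfOp i B cfg O id id).ker U y y' := mul_le_mul_of_nonneg_left hsup (norm_nonneg _)

omit [CompleteSpace 𝔸] in
/-- a coordinate vector vanishing off the block of `y′` (block map `blkHK = fst`) re-assembles, slice by slice, to the amplitude `δ_{y′} ⊗ E_{ν a′}` with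
`E_{ν a′} = Σ_a μ(y′, ν, a, a′)•b_a`. [cite: Balaban1985BackgroundPropagators, (3.126) p.420 + (3.132) p.422 (the input lattice of C), bookkeeping] -/
theorem assembleK_eq_deltaY_of_off {S D : Type} [DecidableEq S] (y' : S) (μ : S × D × κ × κ → ℝ) (hμ : ∀ p : S × D × κ × κ, p.1 ≠ y' → μ p = 0)
    (ν : D) (a' : κ) : assembleK b ν a' μ = deltaY y' (∑ a, μ (y', ν, a, a') • b a) := by
  funext z
  by_cases hz : z = y'
  · subst hz; simp [assembleK, deltaY]
  · have h0 : ∀ a, μ (z, ν, a, a') = 0 := fun a => hμ (z, ν, a, a') hz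
    simp [assembleK, deltaY, hz, h0]

omit [CompleteSpace 𝔸] in
/-- the slice amplitude is dominated by the basis sizes: `‖Σ_a μ(y′, ν, a, a′)•b_a‖ ≤ (Σ_a ‖b_a‖)·B` when `|μ| ≤ B` on the block of `y′`.
[cite: Balaban1985BackgroundPropagators, p.389 («values in 𝔤»), bookkeeping] -/
theorem norm_sliceAmplitude_le {S D : Type} (y' : S) (μ : S × D × κ × κ → ℝ) {Bμ : ℝ} (hB : ∀ p : S × D × κ × κ, p.1 = y' → |μ p| ≤ Bμ)
    (ν : D) (a' : κ) : ‖∑ a, μ (y', ν, a, a') • b a‖ ≤ (∑ a, ‖b a‖) * Bμ := by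
  calc ‖∑ a, μ (y', ν, a, a') • b a‖ ≤ ∑ a, ‖μ (y', ν, a, a') • b a‖ := norm_sum_le _ _
    _ = ∑ a, |μ (y', ν, a, a')| * ‖b a‖ := by simp [norm_smul]
    _ ≤ ∑ a, Bμ * ‖b a‖ := Finset.sum_le_sum fun a _ => mul_le_mul_of_nonneg_right (hB _ rfl) (norm_nonneg _)
    _ = (∑ a, ‖b a‖) * Bμ := by rw [← Finset.mul_sum, mul_comm]

end Reading

/-! ## §3 The class letter from the `ν`-reading (index level, any letter) -/

section Index

variable {κ : Type} [Fintype κ] (b : Module.Basis κ ℝ 𝔸)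
variable (i : KIdx d ℓ hd hL b₀ b₁) [Fintype (geo9K i).Site] (B : B9.Backgrounds) (cfg : B.Cfg → CfgY 𝔸 i)
  (O : CfgY 𝔸 i → (IBondY i → 𝔸) →ₗ[ℂ] (IBondY i → 𝔸))

/-- ★★ **THE FLAT OPERATOR ENTRIES DOMINATE THE COORDINATE MODEL** (`HasMajorant` form over the sharp blocks `blkHK = fst`): for `μ` localised on the block of
`y′` with `|μ| ≤ Bμ`, every coordinate of `c • coordOpK b O μ` over `y` is at most `|c|·M₂·(Σ_a‖b_a‖)·kerflat(y, y′)·Bμ`.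
[cite: Balaban1985BackgroundPropagators, (3.132) p.422 + (3.42) p.397 (the operators read); Balaban1984PropagatorsII, (2.51) p.232 (majorant shape), bookkeeping] -/
theorem hasMajorant_smul_coordOpK_of_siteKernel {M₂ : ℝ} (hM₂ : 0 ≤ M₂) (hrepr : ∀ (v : 𝔸) (j : κ), |b.repr v j| ≤ M₂ * ‖v‖)
    (R₀ : ℝ) (H₀ : Prop) (c : ℝ) (U : B.Cfg) :
    HasMajorant (g := toB6 (geo9K i) R₀ H₀) (blkHK i)
      (c • coordOpK b (fun _ : Fin (d + 1) => (O (cfg U)).restrictScalars ℝ))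
      (fun y y' => |c| * (M₂ * ∑ a, ‖b a‖) * (siteKernelOfOp i B cfg O id id).ker U y y') := by
  rintro y' μ Bμ hsupp ⟨y, ν, a, a'⟩
  have hoff : ∀ q : XHK κ i, q.1 ≠ y' → μ q = 0 := fun q hq => hsupp.off q hq
  have hbd : ∀ q : XHK κ i, q.1 = y' → |μ q| ≤ Bμ := fun q hq => hsupp.bound q hq
  have hE := norm_sliceAmplitude_le (S := IBondY i) b y' μ hbd ν a'
  have hker0 : 0 ≤ (siteKernelOfOp i B cfg O id id).ker U y y' := siteKernelOfOp_ker_nonneg i B cfg O id id U y y'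
  show |(c • coordOpK b (fun _ : Fin (d + 1) => (O (cfg U)).restrictScalars ℝ)) μ (y, ν, a, a')| ≤
    |c| * (M₂ * ∑ a, ‖b a‖) * (siteKernelOfOp i B cfg O id id).ker U y y' * Bμ
  rw [show (c • coordOpK b (fun _ : Fin (d + 1) => (O (cfg U)).restrictScalars ℝ)) μ (y, ν, a, a') =
    c * b.repr (O (cfg U) (assembleK b ν a' μ) y) a from rfl, abs_mul, assembleK_eq_deltaY_of_off (S := IBondY i) b y' μ hoff ν a']
  set E : 𝔸 := ∑ a, μ (y', ν, a, a') • b a with hEdef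
  have h1 : |b.repr (O (cfg U) (deltaY y' E) y) a| ≤ M₂ * ‖O (cfg U) (deltaY y' E) y‖ := hrepr _ _
  have h2 := norm_apply_deltaY_le_norm_mul_siteKernelOfOp_ker b i B cfg O hM₂ hrepr U y y' E
  calc |c| * |b.repr (O (cfg U) (deltaY y' E) y) a| ≤ |c| * (M₂ * (‖E‖ * (siteKernelOfOp i B cfg O id id).ker U y y')) :=
        mul_le_mul_of_nonneg_left (h1.trans (mul_le_mul_of_nonneg_left h2 hM₂)) (abs_nonneg c)
    _ ≤ |c| * (M₂ * (((∑ a, ‖b a‖) * Bμ) * (siteKernelOfOp i B cfg O id id).ker U y y')) :=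
        mul_le_mul_of_nonneg_left (mul_le_mul_of_nonneg_left (mul_le_mul_of_nonneg_right hE hker0) hM₂) (abs_nonneg c)
    _ = |c| * (M₂ * ∑ a, ‖b a‖) * (siteKernelOfOp i B cfg O id id).ker U y y' * Bμ := by ring

/-- the same in the `HasMaj` vocabulary between the sharp-block sup sizes (B11SectG conservativity). [cite: Balaban1984PropagatorsII, (2.51) p.232; Balaban1985BackgroundPropagators, (3.132) p.422, bookkeeping] -/
theorem hasMaj_ofBlocks_smul_coordOpK_of_siteKernel {M₂ : ℝ} (hM₂ : 0 ≤ M₂) (hrepr : ∀ (v : 𝔸) (j : κ), |b.repr v j| ≤ M₂ * ‖v‖)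
    (R₀ : ℝ) (H₀ : Prop) (c : ℝ) (U : B.Cfg) :
    HasMaj (BlockNorm.ofBlocks (toB6 (geo9K i) R₀ H₀) (blkHK i)) (BlockNorm.ofBlocks (toB6 (geo9K i) R₀ H₀) (blkHK i))
      (c • coordOpK b (fun _ : Fin (d + 1) => (O (cfg U)).restrictScalars ℝ))
      (fun y y' => |c| * (M₂ * ∑ a, ‖b a‖) * (siteKernelOfOp i B cfg O id id).ker U y y') :=
  hasMaj_of_hasMajorant (g := toB6 (geo9K i) R₀ H₀) (blkHK i)
    (fun y y' => mul_nonneg (mul_nonneg (abs_nonneg c) (mul_nonneg hM₂ (Finset.sum_nonneg fun _ _ => norm_nonneg _)))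
      (siteKernelOfOp_ker_nonneg i B cfg O id id U y y'))
    (hasMajorant_smul_coordOpK_of_siteKernel b i B cfg O hM₂ hrepr R₀ H₀ c U)

/-- ★★★ **THE KNIT's CLASS LETTER FROM THE `ν`-READING OF (3.132)** (the shape of `B9Thm312WholeHZ.LettersHZ.c2 ∕ c12` at `bZ = n⁻¹-weighted sharp blocks`):
at an index `i` whose `M` clears `2·log L ≤ (δ₁ − δ₃)·(2L² − 1)·M` (`δ₃ < δ₁`), for ANY letter `O` read through `ν = nuY (d+1)`,
`B9.Ineq3132 (d+1) kerν C δ₁ U ⟹ HasMaj 𝔠⁽²⁾ (weightNorm (ofBlocks … blkHK) n⁻¹) (c • coordOpK b O(U)) ((|c|·M₂·S_b·C·L²)·e^{−δ₃d})`.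
[cite: Balaban1985BackgroundPropagators, (3.132) p.422 + (3.42) p.397 + p.398 (remark after (3.47)); Balaban1984PropagatorsII, Lemma 2.1 (2.60) p.234 + (2.51) p.232] -/
theorem hasMaj_cNorm_weightNorm_coordOpK_of_ineq3132Nu {M₂ : ℝ} (hM₂ : 0 ≤ M₂) (hrepr : ∀ (v : 𝔸) (j : κ), |b.repr v j| ≤ M₂ * ‖v‖)
    (R₀ : ℝ) (H₀ : Prop) (c : ℝ) (U : B.Cfg) (hlen : ∀ y : (geo9K i).Site, 0 ≤ (geo9K i).len y)
    (hW : ∀ y : (geo9K i).Site, 0 ≤ (((((ℓ + 1 : ℕ) : ℝ)) ^ (d + 1)) ^ (lvl i.hN i.D i.hk y))⁻¹)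
    {C δ₁ δ₃ : ℝ} (hC : 0 ≤ C) (hδ : δ₃ < δ₁)
    (hM : 2 * Real.log (geo9K i).L ≤ (δ₁ - δ₃) * (2 * ((ℓ : ℝ) + 1) ^ 2 - 1) * (geo9K i).M)
    (h3132 : B9.Ineq3132 (d + 1) (siteKernelOfOpNu i B cfg (nuY (d + 1) i) O) C δ₁ U) :
    HasMaj (cNorm R₀ H₀ (blkHK i) hlen 2)
      (weightNorm (BlockNorm.ofBlocks (toB6 (geo9K i) R₀ H₀) (blkHK i))
        (fun y => (((((ℓ + 1 : ℕ) : ℝ)) ^ (d + 1)) ^ (lvl i.hN i.D i.hk y))⁻¹) hW)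
      (c • coordOpK b (fun _ : Fin (d + 1) => (O (cfg U)).restrictScalars ℝ))
      (fun y y' => |c| * (M₂ * ∑ a, ‖b a‖) * C * (geo9K i).L ^ 2 * Real.exp (-(δ₃ * (geo9K i).dist y y'))) := by
  have h0 := hasMaj_ofBlocks_smul_coordOpK_of_siteKernel b i B cfg O hM₂ hrepr R₀ H₀ c U
  refine B9SectDSup.HasMaj.weight (B9Thm312Whole.wt_nonneg hlen 2) hW h0 fun y y' => ?_
  have hε : 0 < δ₁ - δ₃ := sub_pos.2 hδ; have hleny' : 0 < (geo9K i).len y' := geo9K_len_pos i y'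
  have hA0 : 0 ≤ |c| * (M₂ * ∑ a, ‖b a‖) := mul_nonneg (abs_nonneg c) (mul_nonneg hM₂ (Finset.sum_nonneg fun _ _ => norm_nonneg _))
  set ker : ℝ := (siteKernelOfOp i B cfg O id id).ker U y y'; set W : ℝ := (((((ℓ + 1 : ℕ) : ℝ)) ^ (d + 1)) ^ (lvl i.hN i.D i.hk y))⁻¹
  have h32 : nuY (d + 1) i y * nuY (d + 1) i y' * ker ≤
      C * (geo9K i).len y ^ (-(2 : ℝ)) * (geo9K i).len y' ^ (-(((d + 1 : ℕ) : ℝ))) * Real.exp (-(δ₁ * (geo9K i).dist y y')) := by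
    have h := h3132 y y'; rw [siteKernelOfOpNu_ker] at h; exact (le_abs_self _).trans h
  have hWker : W * ker ≤ C * (geo9K i).len y ^ (-(2 : ℝ)) * Real.exp (-(δ₁ * (geo9K i).dist y y')) := by
    have hpos : 0 < (geo9K i).len y' ^ (-(((d + 1 : ℕ) : ℝ))) := Real.rpow_pos_of_pos hleny' _
    rw [nuY_mul_nuY_eq_levelWeight_mul i y y'] at h32
    have h' : (W * ker) * (geo9K i).len y' ^ (-(((d + 1 : ℕ) : ℝ))) ≤
        (C * (geo9K i).len y ^ (-(2 : ℝ)) * Real.exp (-(δ₁ * (geo9K i).dist y y'))) * (geo9K i).len y' ^ (-(((d + 1 : ℕ) : ℝ))) := by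
      calc (W * ker) * (geo9K i).len y' ^ (-(((d + 1 : ℕ) : ℝ))) = W * (geo9K i).len y' ^ (-(((d + 1 : ℕ) : ℝ))) * ker := by ring
        _ ≤ _ := h32.trans_eq (by ring)
    exact le_of_mul_le_mul_right h' hpos
  have hM' : |(-2 : ℝ)| * Real.log (geo9K i).L ≤ (δ₁ - δ₃) * (2 * ((ℓ : ℝ) + 1) ^ 2 - 1) * (geo9K i).M := by rw [abs_neg, abs_two]; exact hM
  have htr : (geo9K i).len y ^ (-(2 : ℝ)) ≤
      (geo9K i).L ^ |(-2 : ℝ)| * Real.exp ((δ₁ - δ₃) * (geo9K i).dist y' y) * (geo9K i).len y' ^ (-(2 : ℝ)) :=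
    transferL_geo9K i hε (-2) hM' y' y
  have hL2 : (geo9K i).L ^ |(-2 : ℝ)| = (geo9K i).L ^ 2 := by rw [abs_neg, abs_two, Real.rpow_two]
  have hwt : B9Thm312Whole.wt (geo9K i) 2 y' = (geo9K i).len y' ^ (-(2 : ℝ)) := by rw [B9Thm312Whole.wt, Real.rpow_neg hleny'.le, Real.rpow_two]
  have hexp : Real.exp ((δ₁ - δ₃) * (geo9K i).dist y y') * Real.exp (-(δ₁ * (geo9K i).dist y y')) =
      Real.exp (-(δ₃ * (geo9K i).dist y y')) := by rw [← Real.exp_add]; congr 1; ring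
  rw [hL2, geo9K_dist_comm i y' y] at htr; have hexp0 : 0 ≤ Real.exp (-(δ₁ * (geo9K i).dist y y')) := (Real.exp_pos _).le
  show W * (|c| * (M₂ * ∑ a, ‖b a‖) * ker) ≤ |c| * (M₂ * ∑ a, ‖b a‖) * C * (geo9K i).L ^ 2 * Real.exp (-(δ₃ * (geo9K i).dist y y')) * B9Thm312Whole.wt (geo9K i) 2 y'
  rw [hwt]
  calc W * (|c| * (M₂ * ∑ a, ‖b a‖) * ker) = |c| * (M₂ * ∑ a, ‖b a‖) * (W * ker) := by ring
    _ ≤ |c| * (M₂ * ∑ a, ‖b a‖) * (C * (geo9K i).len y ^ (-(2 : ℝ)) * Real.exp (-(δ₁ * (geo9K i).dist y y'))) :=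
        mul_le_mul_of_nonneg_left hWker hA0
    _ ≤ |c| * (M₂ * ∑ a, ‖b a‖) * (C * ((geo9K i).L ^ 2 * Real.exp ((δ₁ - δ₃) * (geo9K i).dist y y') *
          (geo9K i).len y' ^ (-(2 : ℝ))) * Real.exp (-(δ₁ * (geo9K i).dist y y'))) :=
        mul_le_mul_of_nonneg_left (mul_le_mul_of_nonneg_right (mul_le_mul_of_nonneg_left htr hC) hexp0) hA0
    _ = |c| * (M₂ * ∑ a, ‖b a‖) * C * (geo9K i).L ^ 2 *
          (Real.exp ((δ₁ - δ₃) * (geo9K i).dist y y') * Real.exp (-(δ₁ * (geo9K i).dist y y'))) * (geo9K i).len y' ^ (-(2 : ℝ)) := by ring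
    _ = _ := by rw [hexp]

end Index

/-! ## §4 At a member of record (`geo9Y x = geo9K x.toKIdx`) -/

section Member

variable {Mstar : ℕ} {κ : Type} [Fintype κ] (b : Module.Basis κ ℝ 𝔸)
variable [∀ x : MemberY d ℓ hd hL b₀ b₁ Mstar, Fintype (geo9Y x).Site]

/-- ★★ **THE CLASS LETTER FROM THE `ν`-READING, AT A MEMBER `x`** (geometry `geo9Y x`, the certificate's spelling of the weight `n⁻¹` and of the blocks `blkHK x.toKIdx`):
the index-level face verbatim. [cite: Balaban1985BackgroundPropagators, (3.132) p.422 + p.398 (remark after (3.47)); Balaban1984PropagatorsII, Lemma 2.1 (2.60) p.234] -/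
theorem hasMaj_cNorm_weightNorm_coordOpK_geo9Y_of_ineq3132Nu (x : MemberY d ℓ hd hL b₀ b₁ Mstar) (B : B9.Backgrounds)
    (cfg : B.Cfg → CfgY 𝔸 x.toKIdx) (O : CfgY 𝔸 x.toKIdx → (IBondY x.toKIdx → 𝔸) →ₗ[ℂ] (IBondY x.toKIdx → 𝔸))
    {M₂ : ℝ} (hM₂ : 0 ≤ M₂) (hrepr : ∀ (v : 𝔸) (j : κ), |b.repr v j| ≤ M₂ * ‖v‖)
    (R₀ : ℝ) (H₀ : Prop) (c : ℝ) (U : B.Cfg) (hlen : ∀ y : (geo9Y x).Site, 0 ≤ (geo9Y x).len y)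
    (hW : ∀ y : (geo9Y x).Site, 0 ≤ (((((ℓ + 1 : ℕ) : ℝ)) ^ (d + 1)) ^ (lvl x.hN x.D x.hk y))⁻¹)
    {C δ₁ δ₃ : ℝ} (hC : 0 ≤ C) (hδ : δ₃ < δ₁)
    (hM : 2 * Real.log (((ℓ + 1 : ℕ) : ℝ)) ≤ (δ₁ - δ₃) * (2 * ((ℓ : ℝ) + 1) ^ 2 - 1) * (geo9Y x).M)
    (h3132 : B9.Ineq3132 (d + 1) (siteKernelOfOpNu x.toKIdx B cfg (nuY (d + 1) x.toKIdx) O) C δ₁ U) :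
    HasMaj (cNorm R₀ H₀ (blkHK x.toKIdx) hlen 2)
      (weightNorm (BlockNorm.ofBlocks (toB6 (geo9Y x) R₀ H₀) (blkHK x.toKIdx))
        (fun y => (((((ℓ + 1 : ℕ) : ℝ)) ^ (d + 1)) ^ (lvl x.hN x.D x.hk y))⁻¹) hW)
      (c • coordOpK b (fun _ : Fin (d + 1) => (O (cfg U)).restrictScalars ℝ))
      (fun y y' => |c| * (M₂ * ∑ a, ‖b a‖) * C * (((ℓ + 1 : ℕ) : ℝ)) ^ 2 * Real.exp (-(δ₃ * (geo9Y x).dist y y'))) := by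
  letI : Fintype (geo9K x.toKIdx).Site := (inferInstance : Fintype (geo9Y x).Site)
  exact hasMaj_cNorm_weightNorm_coordOpK_of_ineq3132Nu b x.toKIdx B cfg O hM₂ hrepr R₀ H₀ c U hlen hW hC hδ hM h3132

end Member

/-! ## §5 From ROW 26's printed statement: both class letters, member-uniformly, at half the rate -/

section Family

variable {Mstar : ℕ} {κ : Type} [Fintype κ] (b : Module.Basis κ ℝ 𝔸) (G : Subgroup 𝔸ˣ)
variable [∀ x : MemberY d ℓ hd hL b₀ b₁ Mstar, Fintype (geo9Y x).Site]

/-- ★★★ **ROW 26 ⟹ THE TWO CLASS LETTERS `c2 ∕ c12`, MEMBER-UNIFORMLY**: from `B9.Stmt3132Printed (d+1) c35 geo9Y bg9Y (ν-reading of T) (ν-reading of T₁)`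
(row 26's conclusion for two letter families `T, T₁` — at the record `(𝔏 x).QGQinv`, `(𝔏 x).QG1Qinv`) there are `M₄, δ₃ (= δ₁∕2), a₀, B₃ > 0` such that every
member with `M₄ ≤ M`, every `0 < α₀` with `M·α₀ ≤ a₀` and every `U` in the classes (3.35)–(3.36) carry the knit's class letters for the coordinate models
`c • coordOpK b T(U)` and `c • coordOpK b T₁(U)` with the majorant `B₃·e^{−δ₃d}`.  (The printed statement hides its rate: `δ₃` is produced, not prescribed.)
[cite: Balaban1985BackgroundPropagators, (3.132) p.422 (statement before Thm 3.12) + p.398 (remark after (3.47)); Balaban1984PropagatorsII, Lemma 2.1 (2.60) p.234] -/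
theorem hasMaj_cNorm_weightNorm_coordOpK_of_stmt3132Nu
    (T T₁ : ∀ x : MemberY d ℓ hd hL b₀ b₁ Mstar, CfgY 𝔸 x.toKIdx → (IBondY x.toKIdx → 𝔸) →ₗ[ℂ] (IBondY x.toKIdx → 𝔸))
    {M₂ : ℝ} (hM₂ : 0 ≤ M₂) (hrepr : ∀ (v : 𝔸) (j : κ), |b.repr v j| ≤ M₂ * ‖v‖)
    (R₀ : MemberY d ℓ hd hL b₀ b₁ Mstar → ℝ) (H₀ : MemberY d ℓ hd hL b₀ b₁ Mstar → Prop) (c : ℝ)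
    (hlen : ∀ x : MemberY d ℓ hd hL b₀ b₁ Mstar, ∀ y : (geo9Y x).Site, 0 ≤ (geo9Y x).len y)
    (hW : ∀ x : MemberY d ℓ hd hL b₀ b₁ Mstar, ∀ y : (geo9Y x).Site, 0 ≤ (((((ℓ + 1 : ℕ) : ℝ)) ^ (d + 1)) ^ (lvl x.hN x.D x.hk y))⁻¹)
    {c35 : ℝ}
    (h : B9.Stmt3132Printed (d + 1) c35 (geo9Y (d := d) (ℓ := ℓ) (hd := hd) (hL := hL) (b₀ := b₀) (b₁ := b₁) (Mstar := Mstar)) (bg9Y 𝔸 G)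
      (fun x => siteKernelOfOpNu x.toKIdx (bg9Y 𝔸 G x) (fun U => U) (nuY (d + 1) x.toKIdx) (T x))
      (fun x => siteKernelOfOpNu x.toKIdx (bg9Y 𝔸 G x) (fun U => U) (nuY (d + 1) x.toKIdx) (T₁ x))) :
    ∃ M₄ δ₃ a₀ B₃ : ℝ, 0 < M₄ ∧ 0 < δ₃ ∧ 0 < a₀ ∧ 0 < B₃ ∧
      ∀ x : MemberY d ℓ hd hL b₀ b₁ Mstar, M₄ ≤ (geo9Y x).M → ∀ α₀ : ℝ, 0 < α₀ → (geo9Y x).M * α₀ ≤ a₀ →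
        ∀ U : (bg9Y 𝔸 G x).Cfg, (bg9Y 𝔸 G x).Reg335 c35 α₀ U → (bg9Y 𝔸 G x).Reg336 c35 α₀ U →
          HasMaj (cNorm (R₀ x) (H₀ x) (blkHK x.toKIdx) (hlen x) 2)
              (weightNorm (BlockNorm.ofBlocks (toB6 (geo9Y x) (R₀ x) (H₀ x)) (blkHK x.toKIdx))
                (fun y => (((((ℓ + 1 : ℕ) : ℝ)) ^ (d + 1)) ^ (lvl x.hN x.D x.hk y))⁻¹) (hW x))
              (c • coordOpK b (fun _ : Fin (d + 1) => (T x U).restrictScalars ℝ))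
              (fun y y' => B₃ * Real.exp (-(δ₃ * (geo9Y x).dist y y'))) ∧
            HasMaj (cNorm (R₀ x) (H₀ x) (blkHK x.toKIdx) (hlen x) 2)
              (weightNorm (BlockNorm.ofBlocks (toB6 (geo9Y x) (R₀ x) (H₀ x)) (blkHK x.toKIdx))
                (fun y => (((((ℓ + 1 : ℕ) : ℝ)) ^ (d + 1)) ^ (lvl x.hN x.D x.hk y))⁻¹) (hW x))
              (c • coordOpK b (fun _ : Fin (d + 1) => (T₁ x U).restrictScalars ℝ))
              (fun y y' => B₃ * Real.exp (-(δ₃ * (geo9Y x).dist y y'))) := by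
  obtain ⟨M₄, δ₁, a₀, C, hM₄, hδ₁, ha₀, hC, hall⟩ := h
  set Kg : ℝ := (δ₁ - δ₁ / 2) * (2 * ((ℓ : ℝ) + 1) ^ 2 - 1) with hKg
  have hKg0 : 0 < Kg := by
    have h1 : (1 : ℝ) ≤ 2 * ((ℓ : ℝ) + 1) ^ 2 - 1 := by nlinarith [(Nat.cast_nonneg ℓ : (0 : ℝ) ≤ ℓ)]
    have h2 : 0 < δ₁ - δ₁ / 2 := by linarith
    exact mul_pos h2 (by linarith)
  set M₀ : ℝ := 2 * Real.log (((ℓ + 1 : ℕ) : ℝ)) / Kg with hM₀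
  set A : ℝ := |c| * (M₂ * ∑ a, ‖b a‖) * C * (((ℓ + 1 : ℕ) : ℝ)) ^ 2 with hA
  have hA0 : 0 ≤ A := mul_nonneg (mul_nonneg (mul_nonneg (abs_nonneg c) (mul_nonneg hM₂ (Finset.sum_nonneg fun _ _ => norm_nonneg _))) hC.le) (sq_nonneg _)
  refine ⟨max M₄ M₀, δ₁ / 2, a₀, A + 1, lt_max_of_lt_left hM₄, half_pos hδ₁, ha₀, add_pos_of_nonneg_of_pos hA0 one_pos,
    fun x hM α₀ hα ha U hU hU' => ?_⟩
  have hM4 : M₄ ≤ (geo9Y x).M := (le_max_left _ _).trans hM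
  have hgap : 2 * Real.log (((ℓ + 1 : ℕ) : ℝ)) ≤ (δ₁ - δ₁ / 2) * (2 * ((ℓ : ℝ) + 1) ^ 2 - 1) * (geo9Y x).M := by
    have h0 : M₀ ≤ (geo9Y x).M := (le_max_right _ _).trans hM
    rw [hM₀, div_le_iff₀ hKg0] at h0
    simpa [hKg, mul_comm, mul_left_comm, mul_assoc] using h0
  have hboth := hall x hM4 α₀ hα ha U hU hU'
  have hmono : ∀ y y' : (geo9Y x).Site, A * Real.exp (-(δ₁ / 2 * (geo9Y x).dist y y')) ≤ (A + 1) * Real.exp (-(δ₁ / 2 * (geo9Y x).dist y y')) :=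
    fun y y' => mul_le_mul_of_nonneg_right (le_add_of_nonneg_right zero_le_one) (Real.exp_pos _).le
  exact ⟨(hasMaj_cNorm_weightNorm_coordOpK_geo9Y_of_ineq3132Nu b x (bg9Y 𝔸 G x) (fun U => U) (T x) hM₂ hrepr (R₀ x) (H₀ x) c U (hlen x) (hW x)
      hC.le (half_lt_self hδ₁) hgap hboth.1).mono hmono,
    (hasMaj_cNorm_weightNorm_coordOpK_geo9Y_of_ineq3132Nu b x (bg9Y 𝔸 G x) (fun U => U) (T₁ x) hM₂ hrepr (R₀ x) (H₀ x) c U (hlen x) (hW x)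
      hC.le (half_lt_self hδ₁) hgap hboth.2).mono hmono⟩

end Family

end

end Literature.MathematicalPhysics.QuantumFieldTheory.Balaban1983to89.B9Eq3132ClassLetterFromNu
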